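import Summits.BirchSwinnertonDyer.BirchSwinnertonDyer.Theorems.AdditiveBranchIMCTameSpecialization
import HarnessLib

/-!
# AC-LINE SPECIALISATION₂, part (A): the `hK`-FREE lower-bound specialisation `p^k · ch_Λ(X_ac) ⊆ π(ch_{Λ₂}(X_Gr₂))·𝒪⟦T⟧`
# of the two-variable characteristic ideal onto the anticyclotomic line, from CONTROL WITH FINITE-EXPONENT
# KERNEL ALONE (crux `BDPSelmerLowerDivisibilityAtTwo`, stmt-BirchSwinnertonDyer-24728; route `TwoAdicConverse`, S3)

Helper file `--supports stmt-BirchSwinnertonDyer-24728` (cell `bsd-2adic`, seat `bsd-2adic-tower-1` GEN 53; key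
«AC-LINE SPECIALISATION₂» = director-bsd (642)(1), pen SUMMON 20260830T184646Z (S1′)). THEOREMS ONLY (no definition,
no named fact, no instance, no `sorry`).

THE DOOR. The O2 line's residual algebraic object `ch_{Λ_K}(X_Gr₂(E/K̃_∞)) = (C₀)` (two-variable,
`Λ_K = IwasawaAlgebra₂ p = ℤ_p⟦T⟧⟦T₁⟧`) and LINK A₂'s `char_Λ 𝔛_ac = (𝓕)` (one-variable, `Λ = ℤ_p⟦T⟧`, the tree
theorem `TwoAdicBDPAcControl.exists_charIdeal_xAc_eq_span_constantCoeff_ne_zero_of_rankOne`, p782166) live in different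
rings; the door between them is the SPECIALISATION `π = PowerSeries.constantCoeff : Λ_K → Λ` (`T₁ ↦ 0`, the
restriction to the `κ₂`-line) composed with CONTROL `X_Gr₂ ⧸ T₁X_Gr₂ → 𝔛_ac` (the tree's `π`-semilinear
`WeierstrassCurve.XGr₂.toXAcQuot`, `Literature/…/TwoVariableAnticyclotomicControl.lean`). The additive family's S2L file
(`AdditiveBranchIMCTameSpecialization`, ns `…TameSpecialization.S2L`) proves the lower-bound specialisation
`∃ k, C(p^k)·ch_Λ(𝔛_ac)·𝒪⟦T⟧ ⊆ π(ch_{Λ₂}(X_Gr₂)·Λ^ur)` from control-with-exponent AND `hK : E(K)[p] = 0` — `hK` entering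
ONLY through the surjectivity of `toXAcQuot`. On the habitat (β) at `p = 2` (`E[2]` reducible) `hK` is FALSE. This file
removes it: surjectivity is NOT needed in the lower-bound direction.

* §1 `map_le_map_toUnr₂_map_constantCoeff_rat'` — S2L's generic lemma WITHOUT `hf : Surjective f`: with
  `R := range f ⊆ Y`, `0 → R → Y → Y/R → 0` gives `ch(Y) = ch(R)·ch(Y/R) ⊆ ch(R)` (`Module.charIdeal_eq_mul_of_exact`,
  `Y` finitely generated torsion over the Noetherian domain `Λ`), and S2L's lemma applies to the SURJECTION
  `f.rangeRestrict : X/T₁X ↠ R` (same finite-exponent kernel). The cokernel of control only makes `ch(Y)` MORE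
  divisible — harmless in this direction.
* §2 `charIdeal_XAc_map_le_rat'` — the curve-level form on the constructed carriers WITHOUT `hK` (any number field `K`,
  any `p`, any generator pair, `X_ac` torsion, control with exponent): `ψ := toXAcQuot ∘ e` as in S2L l.247–262, no
  surjectivity.
* §3 `charIdeal_XAc_map_le_span_of_twoVar'`, `charIdeal_XAc_map_le_span_of_twoVarSpec'` — the ♭-inclusions WITHOUT
  `hK` (same proofs over §2).

HONEST LABELS: pure commutative algebra + Pontryagin bookkeeping on CONSTRUCTED carriers; nothing about `L`-functions;
the count of record of O2 does not move (a door is not a discharge); BSD is proved for no curve by any of this;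
typed ≠ proved. References: Jetchev–Skinner–Wan, Camb. J. Math. 5 (2017) §3.4 (arXiv:1512.06894 pp. 14–15, Lemma
"bigSelmercontrol" and Corollary); Skinner–Urban, Invent. Math. 195 (2014) §3.2.7–3.2.9; Bourbaki AC VII §4.5.
-/

-- D-0017: single-problem summit, the namespace repeats the problem name by design.
set_option linter.dupNamespace false
set_option autoImplicit false

noncomputable section

open Function
open scoped Pointwise Classical

namespace Summit.BirchSwinnertonDyer.BirchSwinnertonDyer.Theorems.TwoAdicBDPAcLineSpec

open Literature.NumberTheory.EllipticCurves Literature.NumberTheory.EllipticCurves.Module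
open Literature.NumberTheory.EllipticCurves.GreenbergVatsal2000
open Summit.BirchSwinnertonDyer.BirchSwinnertonDyer.Theorems.SignedBaseChangeAcDivSpecialization
open Summit.BirchSwinnertonDyer.BirchSwinnertonDyer.Theorems.TameSpecialization

universe u

/-! ## §1. Generic `Λ₂ → Λ₁` WITHOUT surjectivity of control: `p^k·ch(Y) ⊆ π(ch X)` -/

/-- **Lower-bound specialisation for `Λ₂ = ℤ_p⟦T₂⟧⟦T₁⟧ → Λ₁ = ℤ_p⟦T₂⟧`-modules with control, NO surjectivity.** Let
`X` be a finitely generated `Λ₂`-module, `Y` a finitely generated torsion `Λ₁`-module and `f : X/T₁X → Y` a `Λ₁`-linear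
map (constants `Λ₁`-structure on `X/T₁X`) whose kernel is killed by `p^m` — `f` NEED NOT be onto. Then for every
structure map `J : ℤ_p → 𝒪_{ℂ_p}` there is `k` with `C(p^k)·y ∈ π(ch_{Λ₂}(X)·Λ^ur)` for every `y ∈ ch_{Λ₁}(Y)·𝒪⟦T⟧`:
`ch(Y) = ch(range f)·ch(Y/range f) ⊆ ch(range f)` (`Module.charIdeal_eq_mul_of_exact`), and
`S2L.map_le_map_toUnr₂_map_constantCoeff_rat` for the surjection `f.rangeRestrict`. (Jetchev–Skinner–Wan's
Cor. "bigSelmercontrol" reads the control map only through its finite kernel; the cokernel is irrelevant there too.)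
[cite: JetchevSkinnerWan2017, §3.4 Lemma 15 / Cor. 16 of the arXiv numbering (arXiv:1512.06894 pp. 14–15)]
[cite: SkinnerUrban2014, Cor. 3.2.9 (p. 24)] -/
theorem map_le_map_toUnr₂_map_constantCoeff_rat' (p : ℕ) [Fact p.Prime] (X : Type*) [AddCommGroup X]
    [Module (PowerSeries (IwasawaAlgebra p)) X] [Module.Finite (PowerSeries (IwasawaAlgebra p)) X]
    (Y : Type*) [AddCommGroup Y] [Module (IwasawaAlgebra p) Y] [Module.Finite (IwasawaAlgebra p) Y]
    (hY : Module.IsTorsion (IwasawaAlgebra p) Y)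
    (f : letI : Module (IwasawaAlgebra p)
              (QuotSMulTop (PowerSeries.X : PowerSeries (IwasawaAlgebra p)) X) :=
            Module.compHom _ (PowerSeries.C (R := IwasawaAlgebra p))
      QuotSMulTop (PowerSeries.X : PowerSeries (IwasawaAlgebra p)) X →ₗ[IwasawaAlgebra p] Y)
    (hker : ∃ m : ℕ, ∀ q : QuotSMulTop (PowerSeries.X : PowerSeries (IwasawaAlgebra p)) X, f q = 0 →
      ((p : PowerSeries (IwasawaAlgebra p)) ^ m) • q = 0)
    (J : ℤ_[p] →+* PadicComplexInt p) :
    ∃ k : ℕ, ∀ y ∈ (charIdeal (IwasawaAlgebra p) Y).map (PowerSeries.map J),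
      PowerSeries.C (((p : ℕ) : PadicComplexInt p) ^ k) * y ∈
        ((charIdeal (PowerSeries (IwasawaAlgebra p)) X).map (IwasawaAlgebra₂.toUnr₂ p J)).map
          (PowerSeries.constantCoeff (R := PowerSeries (PadicComplexInt p))) := by
  letI instQ : Module (IwasawaAlgebra p)
      (QuotSMulTop (PowerSeries.X : PowerSeries (IwasawaAlgebra p)) X) :=
    Module.compHom _ (PowerSeries.C (R := IwasawaAlgebra p))
  haveI : IsNoetherian (IwasawaAlgebra p) Y := isNoetherian_of_isNoetherianRing_of_finite _ _
  obtain ⟨m, hm⟩ := hker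
  -- the image `R = range f ⊆ Y`: finitely generated torsion, and `f` co-restricts ONTO it
  haveI : Module.Finite (IwasawaAlgebra p) (LinearMap.range f) :=
    Module.Finite.of_injective (LinearMap.range f).subtype (Submodule.subtype_injective _)
  have hR : Module.IsTorsion (IwasawaAlgebra p) (LinearMap.range f) := fun r => by
    obtain ⟨a, ha⟩ := @hY (r : Y)
    refine ⟨a, Subtype.ext ?_⟩
    rw [Submonoid.smul_def] at ha ⊢
    rw [Submodule.coe_smul, ha, Submodule.coe_zero]
  have hker' : ∃ m : ℕ, ∀ q : QuotSMulTop (PowerSeries.X : PowerSeries (IwasawaAlgebra p)) X,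
      f.rangeRestrict q = 0 → ((p : PowerSeries (IwasawaAlgebra p)) ^ m) • q = 0 := by
    refine ⟨m, fun q hq => hm q ?_⟩
    have h := congrArg Subtype.val hq
    rwa [LinearMap.codRestrict_apply] at h
  obtain ⟨k, hk⟩ := S2L.map_le_map_toUnr₂_map_constantCoeff_rat p X (LinearMap.range f) hR f.rangeRestrict
    f.surjective_rangeRestrict hker' J
  -- `ch(Y) = ch(R) · ch(Y/R) ⊆ ch(R)`
  have h3 := charIdeal_eq_mul_of_exact hY (LinearMap.range f).subtype (LinearMap.range f).mkQ
    (Submodule.subtype_injective _) (Submodule.mkQ_surjective _) (LinearMap.exact_subtype_mkQ _)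
  have hle : charIdeal (IwasawaAlgebra p) Y ≤ charIdeal (IwasawaAlgebra p) (LinearMap.range f) := by
    rw [h3]
    exact Ideal.mul_le_right
  exact ⟨k, fun y hy => hk y (Ideal.map_mono hle hy)⟩

/-! ## §2. The constructed carriers: the curve-level rational specialisation WITHOUT `E(K)[p] = 0` -/

section Curve

open NumberField IsDedekindDomain Field
  Literature.NumberTheory.EllipticCurves.Castella2018 Literature.NumberTheory.EllipticCurves.TwoVariableSelmer

variable {K : Type u} [Field K] [NumberField K] (W : WeierstrassCurve K) (p : ℕ) [Fact p.Prime]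
  (κ₁ κ₂ : ZpExtension K p) (vbar : HeightOneSpectrum (𝓞 K)) (γ₁ γ₂ : Field.absoluteGaloisGroup K)
  [hγ : Fact (ZpExtension.IsTopGeneratorPair κ₁ κ₂ γ₁ γ₂)] [Fact (κ₂.IsTopGenerator γ₂)]

/-- **Rational lower-bound specialisation on the constructed carriers, `hK`-FREE.** For `W` elliptic over a number
field `K`, ANY `p`, a generator pair `(κ₁, κ₂; γ₁, γ₂)`, a place `v̄`, `X_ac = AcSelmer.XAc W p κ₂ v̄ ∅ γ₂` a TORSION
`Λ₁`-module, and CONTROL WITH EXPONENT (every `conj_{γ₁}`-fixed class of `H¹_{nr,v̄}(K̃_∞, E[p^∞]) = unrSelmer₂` has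
`p^m` times it in the range of `selmerAcToUnrSelmer₂`): for every structure map `J` there is `k` with
`C(p^k)·ch_{Λ₁}(X_ac)·𝒪⟦T⟧ ⊆ π(ch_{Λ₂}(X_Gr₂)·Λ^ur)` (membership form). Exactly `S2L.charIdeal_XAc_map_le_rat` with the
hypothesis `hK : E(K)[p] = 0` DROPPED: the map `ψ = toXAcQuot ∘ (X/T₁X ≃ X/(T₁)X)` is used through its kernel only
(`S2L.pow_smul_eq_zero_of_toXAcQuot_eq_zero`), §1 replacing the surjectivity `toXAcQuot_surjective hK`.
[cite: JetchevSkinnerWan2017, §3.4 (arXiv:1512.06894 pp. 14–15)] [cite: SkinnerUrban2014, Prop. 3.2.8, Cor. 3.2.9 (pp. 23–24)] -/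
theorem charIdeal_XAc_map_le_rat' [W.IsElliptic]
    (hYt : Module.IsTorsion (IwasawaAlgebra p) (AcSelmer.XAc W p κ₂ vbar ∅ γ₂))
    (hctl : ∃ m : ℕ, ∀ s : unrSelmer₂ κ₁ κ₂ (W.geomPrimaryTorsion p) vbar,
      conjSel₂ κ₁ κ₂ (W.geomPrimaryTorsion p) vbar γ₁ s = s →
        p ^ m • s ∈ Set.range (W.selmerAcToUnrSelmer₂ p κ₁ κ₂ vbar))
    (J : ℤ_[p] →+* PadicComplexInt p) :
    ∃ k : ℕ, ∀ y ∈ (AcSelmer.XAc.charIdeal W p κ₂ vbar ∅ γ₂).map (PowerSeries.map J),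
      PowerSeries.C (((p : ℕ) : PadicComplexInt p) ^ k) * y ∈
        ((WeierstrassCurve.XGr₂.charIdeal W p κ₁ κ₂ vbar γ₁ γ₂).map (IwasawaAlgebra₂.toUnr₂ p J)).map
          (PowerSeries.constantCoeff (R := PowerSeries (PadicComplexInt p))) := by
  haveI : Module.Finite (IwasawaAlgebra₂ p) (W.XGr₂ p κ₁ κ₂ vbar γ₁ γ₂) :=
    Summit.BirchSwinnertonDyer.BirchSwinnertonDyer.Theorems.SignedBaseChangeAcDivFinitePiece.xGr₂_module_finite
      W p κ₁ κ₂ vbar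
  haveI : Module.Finite (IwasawaAlgebra p) (AcSelmer.XAc W p κ₂ vbar ∅ γ₂) :=
    AcSelmer.XAc.module_finite_empty W p κ₂ vbar γ₂
  obtain ⟨m, hm⟩ := hctl
  -- `X_Gr₂ ⧸ T₁ • ⊤ ≃ X_Gr₂ ⧸ (T₁) • ⊤`, then the tree's semilinear control map, made `Λ₁`-linear
  let e : QuotSMulTop (PowerSeries.X : IwasawaAlgebra₂ p) (W.XGr₂ p κ₁ κ₂ vbar γ₁ γ₂)
      ≃ₗ[IwasawaAlgebra₂ p] (W.XGr₂ p κ₁ κ₂ vbar γ₁ γ₂ ⧸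
        (Ideal.span {(PowerSeries.X : IwasawaAlgebra₂ p)} •
          (⊤ : Submodule (IwasawaAlgebra₂ p) (W.XGr₂ p κ₁ κ₂ vbar γ₁ γ₂)))) :=
    Submodule.quotEquivOfEq _ _
      (Submodule.ideal_span_singleton_smul (PowerSeries.X : IwasawaAlgebra₂ p) ⊤).symm
  let ψ := (WeierstrassCurve.XGr₂.toXAcQuot W p κ₁ κ₂ vbar γ₁ γ₂).comp e.toLinearMap
  letI : Module (IwasawaAlgebra p)
      (QuotSMulTop (PowerSeries.X : IwasawaAlgebra₂ p) (W.XGr₂ p κ₁ κ₂ vbar γ₁ γ₂)) :=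
    Module.compHom _ (PowerSeries.C (R := IwasawaAlgebra p))
  let f : QuotSMulTop (PowerSeries.X : IwasawaAlgebra₂ p) (W.XGr₂ p κ₁ κ₂ vbar γ₁ γ₂) →ₗ[IwasawaAlgebra p]
      AcSelmer.XAc W p κ₂ vbar ∅ γ₂ :=
    { toFun := ψ
      map_add' := ψ.map_add
      map_smul' := fun a q => by
        show ψ ((PowerSeries.C a : IwasawaAlgebra₂ p) • q) = a • ψ q
        rw [ψ.map_smulₛₗ, PowerSeries.constantCoeff_C] }
  have hker : ∃ m : ℕ, ∀ q : QuotSMulTop (PowerSeries.X : IwasawaAlgebra₂ p) (W.XGr₂ p κ₁ κ₂ vbar γ₁ γ₂),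
      f q = 0 → ((p : IwasawaAlgebra₂ p) ^ m) • q = 0 := by
    refine ⟨m, fun q hq => ?_⟩
    have hq' : WeierstrassCurve.XGr₂.toXAcQuot W p κ₁ κ₂ vbar γ₁ γ₂ (e q) = 0 := hq
    have h := S2L.pow_smul_eq_zero_of_toXAcQuot_eq_zero W p κ₁ κ₂ vbar γ₁ γ₂ hm (e q) hq'
    have h2 : e (((p : IwasawaAlgebra₂ p) ^ m) • q) = 0 := by rw [e.map_smul]; exact h
    exact e.map_eq_zero_iff.mp h2
  exact map_le_map_toUnr₂_map_constantCoeff_rat' p (W.XGr₂ p κ₁ κ₂ vbar γ₁ γ₂) (AcSelmer.XAc W p κ₂ vbar ∅ γ₂)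
    hYt f hker J

/-! ## §3. The ♭-inclusions at one datum WITHOUT `E(K)[p] = 0` -/

/-- **The ♭-INCLUSION `ch_Λ(X_ac)·𝒪_{ℂ_p}⟦T⟧ ⊆ (Q)` at one datum, `hK`-FREE**: `S2L.charIdeal_XAc_map_le_span_of_twoVar`
with `hK : E(K)[p] = 0` dropped (proof verbatim over `charIdeal_XAc_map_le_rat'`): from (i) a RATIONAL two-variable
inclusion `p^k·ch_{Λ₂}(X_Gr₂)·Λ^ur ⊆ (G)` whose restriction `G(0,T₂)` generates `(Q)`, (ii) control with exponent, (iii)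
`X_ac` torsion, (iv) `μ(Q) = 0`. [cite: JetchevSkinnerWan2017, §3.4 and Thm. 6.1.4–6.1.5 of the arXiv numbering (arXiv:1512.06894 pp. 14–15, 26)] -/
theorem charIdeal_XAc_map_le_span_of_twoVar' [W.IsElliptic]
    (hYt : Module.IsTorsion (IwasawaAlgebra p) (AcSelmer.XAc W p κ₂ vbar ∅ γ₂))
    (hctl : ∃ m : ℕ, ∀ s : unrSelmer₂ κ₁ κ₂ (W.geomPrimaryTorsion p) vbar,
      conjSel₂ κ₁ κ₂ (W.geomPrimaryTorsion p) vbar γ₁ s = s →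
        p ^ m • s ∈ Set.range (W.selmerAcToUnrSelmer₂ p κ₁ κ₂ vbar))
    (J : ℤ_[p] →+* PadicComplexInt p) (Q : PowerSeries (PadicComplexInt p)) (hμ : HasUnitContent Q)
    (h2 : ∃ (k : ℕ) (G : PowerSeries (PowerSeries (PadicComplexInt p))),
      (∀ y ∈ (WeierstrassCurve.XGr₂.charIdeal W p κ₁ κ₂ vbar γ₁ γ₂).map (IwasawaAlgebra₂.toUnr₂ p J),
        PowerSeries.C (PowerSeries.C (((p : ℕ) : PadicComplexInt p) ^ k)) * y ∈ Ideal.span {G}) ∧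
      Ideal.span {PowerSeries.constantCoeff G} = Ideal.span {Q}) :
    (AcSelmer.XAc.charIdeal W p κ₂ vbar ∅ γ₂).map (PowerSeries.map J) ≤ Ideal.span {Q} := by
  obtain ⟨k, G, hG, hGQ⟩ := h2
  obtain ⟨k', hk'⟩ := charIdeal_XAc_map_le_rat' W p κ₁ κ₂ vbar γ₁ γ₂ hYt hctl J
  -- `π` of the two-variable inclusion: `C(p^k) · w ∈ (Q)` for every `w ∈ π(ch(X_Gr₂)·Λ^ur)`
  have hπ : ∀ w ∈ ((WeierstrassCurve.XGr₂.charIdeal W p κ₁ κ₂ vbar γ₁ γ₂).map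
      (IwasawaAlgebra₂.toUnr₂ p J)).map (PowerSeries.constantCoeff (R := PowerSeries (PadicComplexInt p))),
      PowerSeries.C (((p : ℕ) : PadicComplexInt p) ^ k) * w ∈ Ideal.span {Q} := by
    intro w hw
    rw [← hGQ]
    refine Submodule.span_induction (p := fun w _ => PowerSeries.C (((p : ℕ) : PadicComplexInt p) ^ k) * w ∈
      Ideal.span {PowerSeries.constantCoeff G}) ?_ ?_ ?_ ?_ hw
    · rintro _ ⟨y, hy, rfl⟩
      have h := Ideal.mem_map_of_mem (PowerSeries.constantCoeff (R := PowerSeries (PadicComplexInt p))) (hG y hy)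
      rw [map_mul, PowerSeries.constantCoeff_C, Ideal.map_span, Set.image_singleton] at h
      exact h
    · rw [mul_zero]; exact Ideal.zero_mem _
    · intro a b _ _ ha hb
      rw [mul_add]
      exact Ideal.add_mem _ ha hb
    · intro r a _ ha
      rw [smul_eq_mul, mul_left_comm]
      exact Ideal.mul_mem_left _ r ha
  refine SignedBaseChangeAcDivRatToInt.le_span_of_forall_C_pow_mul_mem_of_hasUnitContent hμ (k := k + k') ?_
  intro y hy
  have h1 := hπ _ (hk' y hy)
  rw [← mul_assoc, ← map_mul, ← pow_add] at h1
  exact h1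

/-- **The ♭-INCLUSION from the ANTICYCLOTOMIC SPECIALISATION of the two-variable characteristic ideal, `hK`-FREE**:
`S2L.charIdeal_XAc_map_le_span_of_twoVarSpec` with `hK` dropped — input `C(p^k) · w ∈ (Q)` for every `w` in
`π(ch_{Λ₂}(X_Gr₂)·Λ^ur)`. [cite: JetchevSkinnerWan2017, §3.4 and Thm. 6.1.4–6.1.5 of the arXiv numbering (arXiv:1512.06894 pp. 14–15, 26)] -/
theorem charIdeal_XAc_map_le_span_of_twoVarSpec' [W.IsElliptic]
    (hYt : Module.IsTorsion (IwasawaAlgebra p) (AcSelmer.XAc W p κ₂ vbar ∅ γ₂))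
    (hctl : ∃ m : ℕ, ∀ s : unrSelmer₂ κ₁ κ₂ (W.geomPrimaryTorsion p) vbar,
      conjSel₂ κ₁ κ₂ (W.geomPrimaryTorsion p) vbar γ₁ s = s →
        p ^ m • s ∈ Set.range (W.selmerAcToUnrSelmer₂ p κ₁ κ₂ vbar))
    (J : ℤ_[p] →+* PadicComplexInt p) (Q : PowerSeries (PadicComplexInt p)) (hμ : HasUnitContent Q)
    (h2 : ∃ k : ℕ, ∀ w ∈ ((WeierstrassCurve.XGr₂.charIdeal W p κ₁ κ₂ vbar γ₁ γ₂).map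
        (IwasawaAlgebra₂.toUnr₂ p J)).map (PowerSeries.constantCoeff (R := PowerSeries (PadicComplexInt p))),
      PowerSeries.C (((p : ℕ) : PadicComplexInt p) ^ k) * w ∈ Ideal.span {Q}) :
    (AcSelmer.XAc.charIdeal W p κ₂ vbar ∅ γ₂).map (PowerSeries.map J) ≤ Ideal.span {Q} := by
  obtain ⟨k, hπ⟩ := h2
  obtain ⟨k', hk'⟩ := charIdeal_XAc_map_le_rat' W p κ₁ κ₂ vbar γ₁ γ₂ hYt hctl J
  refine SignedBaseChangeAcDivRatToInt.le_span_of_forall_C_pow_mul_mem_of_hasUnitContent hμ (k := k + k') ?_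
  intro y hy
  have h1 := hπ _ (hk' y hy)
  rw [← mul_assoc, ← map_mul, ← pow_add] at h1
  exact h1

end Curve

end Summit.BirchSwinnertonDyer.BirchSwinnertonDyer.Theorems.TwoAdicBDPAcLineSpec

end
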